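import Summits.CriticalPhenomena.PercolationContinuityZ3.Theorems.PercNearOneGluingNoHeavyLowerTailFrontierDecRowsClusterBHK3Sandwich
import HarnessLib

/-!
# Eighteen essential INCREASING four-point `E₃` orbits hold on EVERY finite weighted graph — the typed orbits, via the sandwich theorem

Support file (prover prim-ineq-prove-3 gen 11; `--supports stmt-CriticalPhenomena-4575`).  No sorries, no named facts, no definitions, no `native_decide`.

`…FrontierIncRowsLeFive` (prim-bnk-1) proves the 54 essential increasing cubic orbits of prim-masterthm-p1's four-point frontier (FRONTIER-4PT.md, INC table:
50 orbits / 768 rows NOT implied by `T_inc, α, β` + Harris) for graphs with AT MOST FIVE vertices (kernel comb certificates).  This file proves EIGHTEEN of them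
(orbits `1, 3, 5, 9, 11, 13, 14, 15, 18, 20, 25, 28, 30, 38, 39, 40, 43, 52` of that table; 300 rows) for ALL `n`, all weights and ALL terminals (no distinctness
needed), on an arbitrary finite vertex type: they are exactly the TYPED orbits — one event is a group connection `U[S|T]` and the other two are group
connections `U[X|Y]` with a side inside `S`, resp. inside `T`, hence increasing functions of `C_S`, resp. `C_T` — so `…FrontierDecRowsClusterBHK3Sandwich`
(`sahiE3_conn_incr_nonneg`: `0 ≤ Cov(A,B) ≤ E₃({S↔T}, A, B)` for cluster-monotone `A, B`; BHK two-set exchange + Harris) applies.  Among them: the increasing PATH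
`(U[a|b], U[a|c], U[b|y])` (orbit 43) and `(U[ab|cy], U[a|b], U[c|y])` (orbit 52), the increasing twins of the OPEN decreasing rows 36 and 44.
The general statement is `sahiE3_lnk_typed_nonneg₁/₂/₃` (separation-complement in slot 1/2/3).  The remaining 36 − 4 = 32 unimplied increasing orbits
(incl. `γ` and the increasing star) are not typed.
-/

noncomputable section

namespace Summit.CriticalPhenomena.PercolationContinuityZ3.Theorems.FrontierDecRows

open MeasureTheory
open Literature.Probability.Percolation Literature.Probability.LatticeModels
open Literature.Probability.Percolation.TwoSetExchange

variable {V : Type*} [Fintype V]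

omit [Fintype V] in
/-- A group connection `U[X|Y]` with `X ⊆ S` is an increasing function of `C_S`. [this work] -/
theorem clusterMono_lnk_of_left_subset (S X Y : Set V) (hX : X ⊆ S) :
    ∀ ⦃ω ω' : BondConfig V⦄, (⋃ s ∈ S, openEdgeCluster ω s) ⊆ (⋃ s ∈ S, openEdgeCluster ω' s) →
      ω ∈ {ω : BondConfig V | ∃ x ∈ X, ∃ z ∈ Y, (openGraph ω).Reachable x z} →
      ω' ∈ {ω : BondConfig V | ∃ x ∈ X, ∃ z ∈ Y, (openGraph ω).Reachable x z} := by
  rintro ω ω' hs ⟨x, hx, z, hz, hr⟩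
  exact ⟨x, hx, z, hz, typePlus_openConn_of_mem S (∅ : Set V) (hX hx) z hs (by simp) hr⟩

omit [Fintype V] in
/-- A group connection `U[X|Y]` with `Y ⊆ S` is an increasing function of `C_S`. [this work] -/
theorem clusterMono_lnk_of_right_subset (S X Y : Set V) (hY : Y ⊆ S) :
    ∀ ⦃ω ω' : BondConfig V⦄, (⋃ s ∈ S, openEdgeCluster ω s) ⊆ (⋃ s ∈ S, openEdgeCluster ω' s) →
      ω ∈ {ω : BondConfig V | ∃ x ∈ X, ∃ z ∈ Y, (openGraph ω).Reachable x z} →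
      ω' ∈ {ω : BondConfig V | ∃ x ∈ X, ∃ z ∈ Y, (openGraph ω).Reachable x z} := by
  rintro ω ω' hs ⟨x, hx, z, hz, hr⟩
  exact ⟨x, hx, z, hz, (typePlus_openConn_of_mem S (∅ : Set V) (hY hz) x hs (by simp) hr.symm).symm⟩

omit [Fintype V] in
/-- `U[X|Y]` with a side inside `S` is cluster-monotone for `C_S`. [this work] -/
theorem clusterMono_lnk (S X Y : Set V) (h : X ⊆ S ∨ Y ⊆ S) :
    ∀ ⦃ω ω' : BondConfig V⦄, (⋃ s ∈ S, openEdgeCluster ω s) ⊆ (⋃ s ∈ S, openEdgeCluster ω' s) →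
      ω ∈ {ω : BondConfig V | ∃ x ∈ X, ∃ z ∈ Y, (openGraph ω).Reachable x z} →
      ω' ∈ {ω : BondConfig V | ∃ x ∈ X, ∃ z ∈ Y, (openGraph ω).Reachable x z} :=
  h.elim (clusterMono_lnk_of_left_subset S X Y) (clusterMono_lnk_of_right_subset S X Y)

/-- **Typed increasing group-connection triples, separation-complement FIRST**: for `S, T` and group connections `U[X|Y]`, `U[X'|Y']` with a side of the
first inside `S` and a side of the second inside `T`, `0 ≤ E₃(U[S|T], U[X|Y], U[X'|Y'])` on every finite weighted graph. [this work] -/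
theorem sahiE3_lnk_typed_nonneg₁ (w : Sym2 V → unitInterval) (S T X Y X' Y' : Set V) (hA : X ⊆ S ∨ Y ⊆ S) (hB : X' ⊆ T ∨ Y' ⊆ T) :
    0 ≤ sahiE3 (prodBernoulli w) {ω : BondConfig V | ∃ x ∈ S, ∃ z ∈ T, (openGraph ω).Reachable x z}
      {ω : BondConfig V | ∃ x ∈ X, ∃ z ∈ Y, (openGraph ω).Reachable x z}
      {ω : BondConfig V | ∃ x ∈ X', ∃ z ∈ Y', (openGraph ω).Reachable x z} :=
  sahiE3_conn_incr_nonneg w S T (clusterMono_lnk S X Y hA) (clusterMono_lnk T X' Y' hB)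

/-- The same with the separation-complement in the SECOND slot. [this work] -/
theorem sahiE3_lnk_typed_nonneg₂ (w : Sym2 V → unitInterval) (S T X Y X' Y' : Set V) (hA : X ⊆ S ∨ Y ⊆ S) (hB : X' ⊆ T ∨ Y' ⊆ T) :
    0 ≤ sahiE3 (prodBernoulli w) {ω : BondConfig V | ∃ x ∈ X, ∃ z ∈ Y, (openGraph ω).Reachable x z}
      {ω : BondConfig V | ∃ x ∈ S, ∃ z ∈ T, (openGraph ω).Reachable x z}
      {ω : BondConfig V | ∃ x ∈ X', ∃ z ∈ Y', (openGraph ω).Reachable x z} := by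
  rw [sahiE3_comm₁₂]; exact sahiE3_lnk_typed_nonneg₁ w S T X Y X' Y' hA hB

/-- The same with the separation-complement in the THIRD slot. [this work] -/
theorem sahiE3_lnk_typed_nonneg₃ (w : Sym2 V → unitInterval) (S T X Y X' Y' : Set V) (hA : X ⊆ S ∨ Y ⊆ S) (hB : X' ⊆ T ∨ Y' ⊆ T) :
    0 ≤ sahiE3 (prodBernoulli w) {ω : BondConfig V | ∃ x ∈ X, ∃ z ∈ Y, (openGraph ω).Reachable x z}
      {ω : BondConfig V | ∃ x ∈ X', ∃ z ∈ Y', (openGraph ω).Reachable x z}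
      {ω : BondConfig V | ∃ x ∈ S, ∃ z ∈ T, (openGraph ω).Reachable x z} := by
  rw [sahiE3_comm₂₃, sahiE3_comm₁₂]; exact sahiE3_lnk_typed_nonneg₁ w S T X Y X' Y' hA hB

omit [Fintype V] in
/-- `U[S|T] = U[T|S]`. [folklore] -/
theorem lnk_comm (S T : Set V) :
    {ω : BondConfig V | ∃ x ∈ S, ∃ z ∈ T, (openGraph ω).Reachable x z} = {ω : BondConfig V | ∃ x ∈ T, ∃ z ∈ S, (openGraph ω).Reachable x z} := by
  ext ω
  constructor
  · rintro ⟨x, hx, z, hz, h⟩; exact ⟨z, hz, x, hx, h.symm⟩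
  · rintro ⟨x, hx, z, hz, h⟩; exact ⟨z, hz, x, hx, h.symm⟩

/-- Slot-1 variant with the roles of `S` and `T` exchanged in the typing (`A` typed by `T`, `B` by `S`). [this work] -/
theorem sahiE3_lnk_typed_nonneg₁' (w : Sym2 V → unitInterval) (S T X Y X' Y' : Set V) (hA : X ⊆ T ∨ Y ⊆ T) (hB : X' ⊆ S ∨ Y' ⊆ S) :
    0 ≤ sahiE3 (prodBernoulli w) {ω : BondConfig V | ∃ x ∈ S, ∃ z ∈ T, (openGraph ω).Reachable x z}
      {ω : BondConfig V | ∃ x ∈ X, ∃ z ∈ Y, (openGraph ω).Reachable x z}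
      {ω : BondConfig V | ∃ x ∈ X', ∃ z ∈ Y', (openGraph ω).Reachable x z} := by
  rw [lnk_comm S T]; exact sahiE3_lnk_typed_nonneg₁ w T S X Y X' Y' hA hB

/-- Slot-2 variant with exchanged typing. [this work] -/
theorem sahiE3_lnk_typed_nonneg₂' (w : Sym2 V → unitInterval) (S T X Y X' Y' : Set V) (hA : X ⊆ T ∨ Y ⊆ T) (hB : X' ⊆ S ∨ Y' ⊆ S) :
    0 ≤ sahiE3 (prodBernoulli w) {ω : BondConfig V | ∃ x ∈ X, ∃ z ∈ Y, (openGraph ω).Reachable x z}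
      {ω : BondConfig V | ∃ x ∈ S, ∃ z ∈ T, (openGraph ω).Reachable x z}
      {ω : BondConfig V | ∃ x ∈ X', ∃ z ∈ Y', (openGraph ω).Reachable x z} := by
  rw [lnk_comm S T]; exact sahiE3_lnk_typed_nonneg₂ w T S X Y X' Y' hA hB

/-- Slot-3 variant with exchanged typing. [this work] -/
theorem sahiE3_lnk_typed_nonneg₃' (w : Sym2 V → unitInterval) (S T X Y X' Y' : Set V) (hA : X ⊆ T ∨ Y ⊆ T) (hB : X' ⊆ S ∨ Y' ⊆ S) :
    0 ≤ sahiE3 (prodBernoulli w) {ω : BondConfig V | ∃ x ∈ X, ∃ z ∈ Y, (openGraph ω).Reachable x z}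
      {ω : BondConfig V | ∃ x ∈ X', ∃ z ∈ Y', (openGraph ω).Reachable x z}
      {ω : BondConfig V | ∃ x ∈ S, ∃ z ∈ T, (openGraph ω).Reachable x z} := by
  rw [lnk_comm S T]; exact sahiE3_lnk_typed_nonneg₃ w T S X Y X' Y' hA hB

/-! ### The eighteen typed orbits of `…FrontierIncRowsLeFive` (index `i` as there), for all `n` -/

section Orbits

variable (w : Sym2 V → unitInterval) (a b c y : V)

/-- **Orbit 1** of `…FrontierIncRowsLeFive`: `0 ≤ E₃(U[abc|y], U[ab|c], U[ac|by])` for every finite weighted graph and all `a b c y`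
(typed: `U[ac|by]` joins the two groups, the other two events are cluster-monotone for them). [this work] -/
theorem frontierInc_1_all :
    0 ≤ sahiE3 (prodBernoulli w) {ω : BondConfig V | ∃ x ∈ ({a, b, c} : Set V), ∃ z ∈ ({y} : Set V), (openGraph ω).Reachable x z}
      {ω : BondConfig V | ∃ x ∈ ({a, b} : Set V), ∃ z ∈ ({c} : Set V), (openGraph ω).Reachable x z}
      {ω : BondConfig V | ∃ x ∈ ({a, c} : Set V), ∃ z ∈ ({b, y} : Set V), (openGraph ω).Reachable x z} :=
  sahiE3_lnk_typed_nonneg₃' w ({a, c} : Set V) ({b, y} : Set V) ({a, b, c} : Set V) ({y} : Set V) ({a, b} : Set V) ({c} : Set V)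
    (Or.inr (by simp)) (Or.inr (by simp))

/-- **Orbit 3** of `…FrontierIncRowsLeFive`: `0 ≤ E₃(U[abc|y], U[ab|c], U[ay|c])` for every finite weighted graph and all `a b c y`
(typed: `U[ay|c]` joins the two groups, the other two events are cluster-monotone for them). [this work] -/
theorem frontierInc_3_all :
    0 ≤ sahiE3 (prodBernoulli w) {ω : BondConfig V | ∃ x ∈ ({a, b, c} : Set V), ∃ z ∈ ({y} : Set V), (openGraph ω).Reachable x z}
      {ω : BondConfig V | ∃ x ∈ ({a, b} : Set V), ∃ z ∈ ({c} : Set V), (openGraph ω).Reachable x z}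
      {ω : BondConfig V | ∃ x ∈ ({a, y} : Set V), ∃ z ∈ ({c} : Set V), (openGraph ω).Reachable x z} :=
  sahiE3_lnk_typed_nonneg₃ w ({a, y} : Set V) ({c} : Set V) ({a, b, c} : Set V) ({y} : Set V) ({a, b} : Set V) ({c} : Set V)
    (Or.inr (by simp)) (Or.inr (by simp))

/-- **Orbit 5** of `…FrontierIncRowsLeFive`: `0 ≤ E₃(U[abc|y], U[ab|cy], U[ay|b])` for every finite weighted graph and all `a b c y`
(typed: `U[ab|cy]` joins the two groups, the other two events are cluster-monotone for them). [this work] -/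
theorem frontierInc_5_all :
    0 ≤ sahiE3 (prodBernoulli w) {ω : BondConfig V | ∃ x ∈ ({a, b, c} : Set V), ∃ z ∈ ({y} : Set V), (openGraph ω).Reachable x z}
      {ω : BondConfig V | ∃ x ∈ ({a, b} : Set V), ∃ z ∈ ({c, y} : Set V), (openGraph ω).Reachable x z}
      {ω : BondConfig V | ∃ x ∈ ({a, y} : Set V), ∃ z ∈ ({b} : Set V), (openGraph ω).Reachable x z} :=
  sahiE3_lnk_typed_nonneg₂' w ({a, b} : Set V) ({c, y} : Set V) ({a, b, c} : Set V) ({y} : Set V) ({a, y} : Set V) ({b} : Set V)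
    (Or.inr (by simp)) (Or.inr (by simp))

/-- **Orbit 9** of `…FrontierIncRowsLeFive`: `0 ≤ E₃(U[abc|y], U[ay|b], U[b|c])` for every finite weighted graph and all `a b c y`
(typed: `U[ay|b]` joins the two groups, the other two events are cluster-monotone for them). [this work] -/
theorem frontierInc_9_all :
    0 ≤ sahiE3 (prodBernoulli w) {ω : BondConfig V | ∃ x ∈ ({a, b, c} : Set V), ∃ z ∈ ({y} : Set V), (openGraph ω).Reachable x z}
      {ω : BondConfig V | ∃ x ∈ ({a, y} : Set V), ∃ z ∈ ({b} : Set V), (openGraph ω).Reachable x z}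
      {ω : BondConfig V | ∃ x ∈ ({b} : Set V), ∃ z ∈ ({c} : Set V), (openGraph ω).Reachable x z} :=
  sahiE3_lnk_typed_nonneg₂ w ({a, y} : Set V) ({b} : Set V) ({a, b, c} : Set V) ({y} : Set V) ({b} : Set V) ({c} : Set V)
    (Or.inr (by simp)) (Or.inl (by simp))

/-- **Orbit 11** of `…FrontierIncRowsLeFive`: `0 ≤ E₃(U[ab|c], U[ac|b], U[ay|b])` for every finite weighted graph and all `a b c y`
(typed: `U[ac|b]` joins the two groups, the other two events are cluster-monotone for them). [this work] -/
theorem frontierInc_11_all :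
    0 ≤ sahiE3 (prodBernoulli w) {ω : BondConfig V | ∃ x ∈ ({a, b} : Set V), ∃ z ∈ ({c} : Set V), (openGraph ω).Reachable x z}
      {ω : BondConfig V | ∃ x ∈ ({a, c} : Set V), ∃ z ∈ ({b} : Set V), (openGraph ω).Reachable x z}
      {ω : BondConfig V | ∃ x ∈ ({a, y} : Set V), ∃ z ∈ ({b} : Set V), (openGraph ω).Reachable x z} :=
  sahiE3_lnk_typed_nonneg₂ w ({a, c} : Set V) ({b} : Set V) ({a, b} : Set V) ({c} : Set V) ({a, y} : Set V) ({b} : Set V)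
    (Or.inr (by simp)) (Or.inr (by simp))

/-- **Orbit 13** of `…FrontierIncRowsLeFive`: `0 ≤ E₃(U[ab|c], U[ac|b], U[b|y])` for every finite weighted graph and all `a b c y`
(typed: `U[ac|b]` joins the two groups, the other two events are cluster-monotone for them). [this work] -/
theorem frontierInc_13_all :
    0 ≤ sahiE3 (prodBernoulli w) {ω : BondConfig V | ∃ x ∈ ({a, b} : Set V), ∃ z ∈ ({c} : Set V), (openGraph ω).Reachable x z}
      {ω : BondConfig V | ∃ x ∈ ({a, c} : Set V), ∃ z ∈ ({b} : Set V), (openGraph ω).Reachable x z}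
      {ω : BondConfig V | ∃ x ∈ ({b} : Set V), ∃ z ∈ ({y} : Set V), (openGraph ω).Reachable x z} :=
  sahiE3_lnk_typed_nonneg₂ w ({a, c} : Set V) ({b} : Set V) ({a, b} : Set V) ({c} : Set V) ({b} : Set V) ({y} : Set V)
    (Or.inr (by simp)) (Or.inl (by simp))

/-- **Orbit 14** of `…FrontierIncRowsLeFive`: `0 ≤ E₃(U[ab|c], U[ac|by], U[ay|b])` for every finite weighted graph and all `a b c y`
(typed: `U[ac|by]` joins the two groups, the other two events are cluster-monotone for them). [this work] -/
theorem frontierInc_14_all :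
    0 ≤ sahiE3 (prodBernoulli w) {ω : BondConfig V | ∃ x ∈ ({a, b} : Set V), ∃ z ∈ ({c} : Set V), (openGraph ω).Reachable x z}
      {ω : BondConfig V | ∃ x ∈ ({a, c} : Set V), ∃ z ∈ ({b, y} : Set V), (openGraph ω).Reachable x z}
      {ω : BondConfig V | ∃ x ∈ ({a, y} : Set V), ∃ z ∈ ({b} : Set V), (openGraph ω).Reachable x z} :=
  sahiE3_lnk_typed_nonneg₂ w ({a, c} : Set V) ({b, y} : Set V) ({a, b} : Set V) ({c} : Set V) ({a, y} : Set V) ({b} : Set V)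
    (Or.inr (by simp)) (Or.inr (by simp))

/-- **Orbit 15** of `…FrontierIncRowsLeFive`: `0 ≤ E₃(U[ab|c], U[ac|by], U[b|y])` for every finite weighted graph and all `a b c y`
(typed: `U[ac|by]` joins the two groups, the other two events are cluster-monotone for them). [this work] -/
theorem frontierInc_15_all :
    0 ≤ sahiE3 (prodBernoulli w) {ω : BondConfig V | ∃ x ∈ ({a, b} : Set V), ∃ z ∈ ({c} : Set V), (openGraph ω).Reachable x z}
      {ω : BondConfig V | ∃ x ∈ ({a, c} : Set V), ∃ z ∈ ({b, y} : Set V), (openGraph ω).Reachable x z}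
      {ω : BondConfig V | ∃ x ∈ ({b} : Set V), ∃ z ∈ ({y} : Set V), (openGraph ω).Reachable x z} :=
  sahiE3_lnk_typed_nonneg₂ w ({a, c} : Set V) ({b, y} : Set V) ({a, b} : Set V) ({c} : Set V) ({b} : Set V) ({y} : Set V)
    (Or.inr (by simp)) (Or.inl (by simp))

/-- **Orbit 18** of `…FrontierIncRowsLeFive`: `0 ≤ E₃(U[ab|c], U[ac|y], U[b|y])` for every finite weighted graph and all `a b c y`
(typed: `U[ac|y]` joins the two groups, the other two events are cluster-monotone for them). [this work] -/
theorem frontierInc_18_all :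
    0 ≤ sahiE3 (prodBernoulli w) {ω : BondConfig V | ∃ x ∈ ({a, b} : Set V), ∃ z ∈ ({c} : Set V), (openGraph ω).Reachable x z}
      {ω : BondConfig V | ∃ x ∈ ({a, c} : Set V), ∃ z ∈ ({y} : Set V), (openGraph ω).Reachable x z}
      {ω : BondConfig V | ∃ x ∈ ({b} : Set V), ∃ z ∈ ({y} : Set V), (openGraph ω).Reachable x z} :=
  sahiE3_lnk_typed_nonneg₂ w ({a, c} : Set V) ({y} : Set V) ({a, b} : Set V) ({c} : Set V) ({b} : Set V) ({y} : Set V)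
    (Or.inr (by simp)) (Or.inr (by simp))

/-- **Orbit 20** of `…FrontierIncRowsLeFive`: `0 ≤ E₃(U[abc|y], U[aby|c], U[ac|by])` for every finite weighted graph and all `a b c y`
(typed: `U[ac|by]` joins the two groups, the other two events are cluster-monotone for them). [this work] -/
theorem frontierInc_20_all :
    0 ≤ sahiE3 (prodBernoulli w) {ω : BondConfig V | ∃ x ∈ ({a, b, c} : Set V), ∃ z ∈ ({y} : Set V), (openGraph ω).Reachable x z}
      {ω : BondConfig V | ∃ x ∈ ({a, b, y} : Set V), ∃ z ∈ ({c} : Set V), (openGraph ω).Reachable x z}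
      {ω : BondConfig V | ∃ x ∈ ({a, c} : Set V), ∃ z ∈ ({b, y} : Set V), (openGraph ω).Reachable x z} :=
  sahiE3_lnk_typed_nonneg₃' w ({a, c} : Set V) ({b, y} : Set V) ({a, b, c} : Set V) ({y} : Set V) ({a, b, y} : Set V) ({c} : Set V)
    (Or.inr (by simp)) (Or.inr (by simp))

/-- **Orbit 25** of `…FrontierIncRowsLeFive`: `0 ≤ E₃(U[abc|y], U[ab|cy], U[a|b])` for every finite weighted graph and all `a b c y`
(typed: `U[ab|cy]` joins the two groups, the other two events are cluster-monotone for them). [this work] -/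
theorem frontierInc_25_all :
    0 ≤ sahiE3 (prodBernoulli w) {ω : BondConfig V | ∃ x ∈ ({a, b, c} : Set V), ∃ z ∈ ({y} : Set V), (openGraph ω).Reachable x z}
      {ω : BondConfig V | ∃ x ∈ ({a, b} : Set V), ∃ z ∈ ({c, y} : Set V), (openGraph ω).Reachable x z}
      {ω : BondConfig V | ∃ x ∈ ({a} : Set V), ∃ z ∈ ({b} : Set V), (openGraph ω).Reachable x z} :=
  sahiE3_lnk_typed_nonneg₂' w ({a, b} : Set V) ({c, y} : Set V) ({a, b, c} : Set V) ({y} : Set V) ({a} : Set V) ({b} : Set V)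
    (Or.inr (by simp)) (Or.inl (by simp))

/-- **Orbit 28** of `…FrontierIncRowsLeFive`: `0 ≤ E₃(U[abc|y], U[ay|b], U[b|cy])` for every finite weighted graph and all `a b c y`
(typed: `U[b|cy]` joins the two groups, the other two events are cluster-monotone for them). [this work] -/
theorem frontierInc_28_all :
    0 ≤ sahiE3 (prodBernoulli w) {ω : BondConfig V | ∃ x ∈ ({a, b, c} : Set V), ∃ z ∈ ({y} : Set V), (openGraph ω).Reachable x z}
      {ω : BondConfig V | ∃ x ∈ ({a, y} : Set V), ∃ z ∈ ({b} : Set V), (openGraph ω).Reachable x z}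
      {ω : BondConfig V | ∃ x ∈ ({b} : Set V), ∃ z ∈ ({c, y} : Set V), (openGraph ω).Reachable x z} :=
  sahiE3_lnk_typed_nonneg₃' w ({b} : Set V) ({c, y} : Set V) ({a, b, c} : Set V) ({y} : Set V) ({a, y} : Set V) ({b} : Set V)
    (Or.inr (by simp)) (Or.inr (by simp))

/-- **Orbit 30** of `…FrontierIncRowsLeFive`: `0 ≤ E₃(U[ab|c], U[ab|y], U[ac|by])` for every finite weighted graph and all `a b c y`
(typed: `U[ac|by]` joins the two groups, the other two events are cluster-monotone for them). [this work] -/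
theorem frontierInc_30_all :
    0 ≤ sahiE3 (prodBernoulli w) {ω : BondConfig V | ∃ x ∈ ({a, b} : Set V), ∃ z ∈ ({c} : Set V), (openGraph ω).Reachable x z}
      {ω : BondConfig V | ∃ x ∈ ({a, b} : Set V), ∃ z ∈ ({y} : Set V), (openGraph ω).Reachable x z}
      {ω : BondConfig V | ∃ x ∈ ({a, c} : Set V), ∃ z ∈ ({b, y} : Set V), (openGraph ω).Reachable x z} :=
  sahiE3_lnk_typed_nonneg₃ w ({a, c} : Set V) ({b, y} : Set V) ({a, b} : Set V) ({c} : Set V) ({a, b} : Set V) ({y} : Set V)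
    (Or.inr (by simp)) (Or.inr (by simp))

/-- **Orbit 38** of `…FrontierIncRowsLeFive`: `0 ≤ E₃(U[ab|c], U[ac|by], U[b|cy])` for every finite weighted graph and all `a b c y`
(typed: `U[ac|by]` joins the two groups, the other two events are cluster-monotone for them). [this work] -/
theorem frontierInc_38_all :
    0 ≤ sahiE3 (prodBernoulli w) {ω : BondConfig V | ∃ x ∈ ({a, b} : Set V), ∃ z ∈ ({c} : Set V), (openGraph ω).Reachable x z}
      {ω : BondConfig V | ∃ x ∈ ({a, c} : Set V), ∃ z ∈ ({b, y} : Set V), (openGraph ω).Reachable x z}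
      {ω : BondConfig V | ∃ x ∈ ({b} : Set V), ∃ z ∈ ({c, y} : Set V), (openGraph ω).Reachable x z} :=
  sahiE3_lnk_typed_nonneg₂ w ({a, c} : Set V) ({b, y} : Set V) ({a, b} : Set V) ({c} : Set V) ({b} : Set V) ({c, y} : Set V)
    (Or.inr (by simp)) (Or.inl (by simp))

/-- **Orbit 39** of `…FrontierIncRowsLeFive`: `0 ≤ E₃(U[ab|c], U[ac|y], U[bc|y])` for every finite weighted graph and all `a b c y`
(typed: `U[bc|y]` joins the two groups, the other two events are cluster-monotone for them). [this work] -/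
theorem frontierInc_39_all :
    0 ≤ sahiE3 (prodBernoulli w) {ω : BondConfig V | ∃ x ∈ ({a, b} : Set V), ∃ z ∈ ({c} : Set V), (openGraph ω).Reachable x z}
      {ω : BondConfig V | ∃ x ∈ ({a, c} : Set V), ∃ z ∈ ({y} : Set V), (openGraph ω).Reachable x z}
      {ω : BondConfig V | ∃ x ∈ ({b, c} : Set V), ∃ z ∈ ({y} : Set V), (openGraph ω).Reachable x z} :=
  sahiE3_lnk_typed_nonneg₃ w ({b, c} : Set V) ({y} : Set V) ({a, b} : Set V) ({c} : Set V) ({a, c} : Set V) ({y} : Set V)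
    (Or.inr (by simp)) (Or.inr (by simp))

/-- **Orbit 40** of `…FrontierIncRowsLeFive`: `0 ≤ E₃(U[ab|c], U[a|b], U[c|y])` for every finite weighted graph and all `a b c y`
(typed: `U[ab|c]` joins the two groups, the other two events are cluster-monotone for them). [this work] -/
theorem frontierInc_40_all :
    0 ≤ sahiE3 (prodBernoulli w) {ω : BondConfig V | ∃ x ∈ ({a, b} : Set V), ∃ z ∈ ({c} : Set V), (openGraph ω).Reachable x z}
      {ω : BondConfig V | ∃ x ∈ ({a} : Set V), ∃ z ∈ ({b} : Set V), (openGraph ω).Reachable x z}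
      {ω : BondConfig V | ∃ x ∈ ({c} : Set V), ∃ z ∈ ({y} : Set V), (openGraph ω).Reachable x z} :=
  sahiE3_lnk_typed_nonneg₁ w ({a, b} : Set V) ({c} : Set V) ({a} : Set V) ({b} : Set V) ({c} : Set V) ({y} : Set V)
    (Or.inl (by simp)) (Or.inl (by simp))

/-- **Orbit 43** of `…FrontierIncRowsLeFive`: `0 ≤ E₃(U[a|b], U[a|c], U[b|y])` for every finite weighted graph and all `a b c y`
(typed: `U[a|b]` joins the two groups, the other two events are cluster-monotone for them). [this work] -/
theorem frontierInc_43_all :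
    0 ≤ sahiE3 (prodBernoulli w) {ω : BondConfig V | ∃ x ∈ ({a} : Set V), ∃ z ∈ ({b} : Set V), (openGraph ω).Reachable x z}
      {ω : BondConfig V | ∃ x ∈ ({a} : Set V), ∃ z ∈ ({c} : Set V), (openGraph ω).Reachable x z}
      {ω : BondConfig V | ∃ x ∈ ({b} : Set V), ∃ z ∈ ({y} : Set V), (openGraph ω).Reachable x z} :=
  sahiE3_lnk_typed_nonneg₁ w ({a} : Set V) ({b} : Set V) ({a} : Set V) ({c} : Set V) ({b} : Set V) ({y} : Set V)
    (Or.inl (by simp)) (Or.inl (by simp))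

/-- **Orbit 52** of `…FrontierIncRowsLeFive`: `0 ≤ E₃(U[ab|cy], U[a|b], U[c|y])` for every finite weighted graph and all `a b c y`
(typed: `U[ab|cy]` joins the two groups, the other two events are cluster-monotone for them). [this work] -/
theorem frontierInc_52_all :
    0 ≤ sahiE3 (prodBernoulli w) {ω : BondConfig V | ∃ x ∈ ({a, b} : Set V), ∃ z ∈ ({c, y} : Set V), (openGraph ω).Reachable x z}
      {ω : BondConfig V | ∃ x ∈ ({a} : Set V), ∃ z ∈ ({b} : Set V), (openGraph ω).Reachable x z}
      {ω : BondConfig V | ∃ x ∈ ({c} : Set V), ∃ z ∈ ({y} : Set V), (openGraph ω).Reachable x z} :=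
  sahiE3_lnk_typed_nonneg₁ w ({a, b} : Set V) ({c, y} : Set V) ({a} : Set V) ({b} : Set V) ({c} : Set V) ({y} : Set V)
    (Or.inl (by simp)) (Or.inl (by simp))

end Orbits

end Summit.CriticalPhenomena.PercolationContinuityZ3.Theorems.FrontierDecRows

end
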